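import Literature.AnabelianGeometry.SemiGraphs.TemperedAbsolutenessReductions

/-!
# [SemiAnbd] Thm. 6.12: the printed reduction to the profinite [Mzk8] Thm. 4.3 over the typed interface

Mochizuki, *Semi-graphs of anabelioids*, Publ. RIMS **42** (2006) [SemiAnbd], §6 p. 78, Theorem 6.12
(Rigidity of Cuspidal Geometric Decomposition Groups).  PROOF-ONLY companion (abc-iut seat f-167, F
fact-proving wave, tranche 167; rung LADDER-ABC:A2.C) of abc-iut-L3-t4's `TemperedAbsoluteness.lean`
(FROZEN; imported, never edited) for the FROZEN FACT-LIST row **F-1653**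
`AbsolutenessOrigin.CuspidalCyclotomicRigidityHolds`.  Its universal closure over the origin certificate
`Ω` is REFUTED in the tree (abc-iut-w6-d028, `TemperedAbsolutenessCyclotomicRigiditySchemaNegative.lean`:
`AbsolutenessOrigin.not_forall_cuspidalCyclotomicRigidityHolds`), so the row is consumable at the genuine
certificate only.  This file records the POSITIVE side — the printed proof, which is ONE sentence
(p. 78): "Finally, we also observe that it is immediate that the tempered analogue of [Mzk8], Theorem 4.3,
holds", glossed by Remark 6.12.1: "Corollaries 6.10, 6.11; Theorem 6.12 [… unlike Thm. 6.8 (iii), (iv),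
Cor. 6.9 …] follow formally from their profinite analogues".  The formal passage, over the typed
interface `TemperedCurve p` / `CyclotomeTransport`:

* every isomorphism of tempered groups `α : Π^temp_{X_K} ⥲ Π^temp_{Y_L}` completes to an isomorphism
  `α̂ : Π_{X_K} ⥲ Π_{Y_L}` of the profinite completions with `α̂ ∘ ι_X = ι_Y ∘ α` (PROVED in the tree:
  `TemperedCurve.temperedIsoCompletes_holds`, [SemiAnbd] Thm. 6.6 proof p. 72 first sentence);
* `α(I_x) = I_y` gives `α̂(Î_x) = Î_y` for the profinite cuspidal geometric decomposition groups
  `Î_x := closure ι_X(I_x) ⊆ Π_{X_K}` (the convention of `TemperedCurve.decompHat`; transport lemma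
  `TemperedCurve.map_closure_map_toHat_eq_of_completes` of abc-iut-f-168), and at a cusp `Î_x = ι_X(I_x)`
  since `I_x ≅ Ẑ(1)` is compact and `Π_{X_K}` is Hausdorff (`closure_map_toHat_inertia_eq`, PROVED);
* the PROFINITE statement — [Mzk8] = [GalSect] Thm. 4.3 (S. Mochizuki, *Galois sections in absolute
  anabelian geometry*, Nagoya Math. J. **179** (2005), Thm. 4.3 p. 17) for `α̂` and the completed data —
  then reads `α̂(ι_X(μ → I_x)(ζ)) = ι_Y((μ → I_y)(ĉ(α̂) ζ))`, and the injectivity of `ι_Y : Π^temp ↪ Π̂`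
  (`TemperedCurve.toHat_injective`, p. 69 "natural injection") together with the COMPATIBILITY LAW
  `ĉ(α̂) = c.cycloOf α` ("the isomorphism `μ_Ẑ(K̄) ⥲ μ_Ẑ(L̄)` induced by `α`" IS the one induced by its
  completion — the cyclotome is reconstructed group-theoretically from the PROFINITE data, [GalSect] §4
  p. 17 / [AbsAnab] Prop. 1.2.1) yields the tempered statement `X.CuspidalCyclotomicRigidity Y c`.

INPUTS, NAMED.  The profinite Thm. 4.3 enters as a HYPOTHESIS BINDER (`hrigid`) over the completed data
of the pair, with the profinite cyclotome transport `ĉ : (Π_{X_K} ⥲ Π_{Y_L}) → (μ ⥲ μ)` a bound datum and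
the compatibility law `hcompat` a hypothesis: the typed record `CyclotomeTransport` carries `cycloOf`
only for TEMPERED isomorphisms and no law.  [GalSect] Thm. 4.3 IS typed in the tree, as the FACT-LIST
row F-0105 `Literature.AnabelianGeometry.AbsoluteAnabelian.GalSect.Thm_4_3 T sx sy`, but over the
interface `FundamentalExtension` / `CuspidalData` / `GaloisCyclotome` of [AbsTopIII]-side seats; the
binder `hrigid` below is its reading on the `TemperedCurve` side (same sentence: "`α` induces
`I_x ⥲ I_y` … compatible with the natural isomorphisms `μ ⥲ I_x`, `μ ⥲ I_y`", with `T.map α_G` in the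
role of `ĉ α̂`).  A by-name junction F-1653 ⟸ F-0105 would need a bridge of GENUINE data
(`Π_{X_K}` as a `ProfiniteGrp` extension of `G_K`, a finite `CuspidalData` with non-conjugate
decomposition groups, a functorial Galois cyclotome) that the tree does not hold -- TODO-merge
(abc-iut-L4-t4 / the F-0105 lineage abc-iut-f-097).  No new `Prop` definition, no new named fact, no
GAP row; nothing is asserted.
HONEST FRAMING: statements about OUR typed interface of a refereed prerequisite paper; the hypotheses
named "law" are properties the genuine data have in print which the typed records do not carry; typed ≠
proved; laws ≠ facts; no bearing on, and no side taken on, [IUTchIII] Cor. 3.12.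
[cite: MochizukiSemiAnbd2006, Thm 6.12 p.78] [cite: MochizukiSemiAnbd2006, Rmk 6.12.1 p.78]
[cite: MochizukiGalSect2005, Thm 4.3 p.17]
-/

noncomputable section

namespace Literature.AnabelianGeometry.SemiGraphs

open scoped Pointwise
open _root_.Topology
open Literature.AnabelianGeometry.EtaleTheta (cyclotome)

variable {p : ℕ} [Fact p.Prime]

namespace TemperedCurve

variable {X Y : TemperedCurve p}

/-! ### 1. The profinite cuspidal geometric decomposition group `Î_x = closure ι_X(I_x)` at a cusp -/

/-- `I_x ≅ Ẑ(1)` at a cusp (interface field `inertia_equiv_zHat`, [SemiAnbd] p. 71 "`I_x` is isomorphic to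
`Ẑ(1)` if `x` is a cusp"), so `I_x ⊆ Π^temp_{X_K}` is compact. [cite: MochizukiSemiAnbd2006, §6 p.71] -/
theorem isCompact_coe_inertia (x : X.Pt) (hx : X.IsCusp x) :
    IsCompact ((X.inertia x : Subgroup X.PiTemp) : Set X.PiTemp) := by
  obtain ⟨e⟩ := X.inertia_equiv_zHat x hx
  haveI : CompactSpace ↥(X.decomp x ⊓ X.aug.toMonoidHom.ker) := e.toHomeomorph.symm.compactSpace
  have h : X.inertia x = X.decomp x ⊓ X.aug.toMonoidHom.ker := rfl
  rw [h]
  exact isCompact_iff_compactSpace.mpr this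

/-- At a cusp the "profinite `I_x ⊆ Π_{X_K}`" needs no closure: `closure ι_X(I_x) = ι_X(I_x)` (compact image
in the Hausdorff `Π_{X_K}`; p. 77 "`D̂_x` also forms a 'profinite `D_x ⊆ Π_{X_K}`'", p. 69 `∧` = "closure in
`Π_{X_K}`"). [cite: MochizukiSemiAnbd2006, §6 p.77] -/
theorem closure_map_toHat_inertia_eq (x : X.Pt) (hx : X.IsCusp x) :
    ((X.inertia x).map X.toHat.toMonoidHom).topologicalClosure = (X.inertia x).map X.toHat.toMonoidHom := by
  haveI : T2Space X.PiHat := X.isProfiniteCompletion_toHat.t2Space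
  apply SetLike.coe_injective
  rw [Subgroup.topologicalClosure_coe, Subgroup.coe_map]
  exact ((isCompact_coe_inertia x hx).image X.toHat.continuous).isClosed.closure_eq

/-- Transport of the images WITHOUT closure (pure algebra): if `α̂ ∘ ι_X = ι_Y ∘ α` then
`α̂(ι_X(S)) = ι_Y(α(S))` for every subgroup `S ⊆ Π^temp_{X_K}`. [cite: MochizukiSemiAnbd2006, Thm 6.6 proof p.72] -/
theorem map_map_toHat_eq_of_completes (αhat : X.PiHat ≃ₜ* Y.PiHat) (α : X.PiTemp ≃ₜ* Y.PiTemp)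
    (h : ∀ g : X.PiTemp, αhat (X.toHat g) = Y.toHat (α g)) (S : Subgroup X.PiTemp) :
    (S.map X.toHat.toMonoidHom).map αhat.toMulEquiv.toMonoidHom =
      (S.map α.toMulEquiv.toMonoidHom).map Y.toHat.toMonoidHom := by
  rw [Subgroup.map_map, Subgroup.map_map]
  congr 1
  exact MonoidHom.ext fun g => h g

/-- `α(I_x) = I_y` for a tempered `α` gives `α̂(Î_x) = Î_y` for its completion `α̂` (closure convention).
[cite: MochizukiSemiAnbd2006, Thm 6.12 p.78] -/
theorem map_closure_inertia_eq_of_completes (αhat : X.PiHat ≃ₜ* Y.PiHat) (α : X.PiTemp ≃ₜ* Y.PiTemp)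
    (h : ∀ g : X.PiTemp, αhat (X.toHat g) = Y.toHat (α g)) (x : X.Pt) (y : Y.Pt)
    (hI : (X.inertia x).map α.toMulEquiv.toMonoidHom = Y.inertia y) :
    (((X.inertia x).map X.toHat.toMonoidHom).topologicalClosure).map αhat.toMulEquiv.toMonoidHom =
      ((Y.inertia y).map Y.toHat.toMonoidHom).topologicalClosure := by
  rw [map_closure_map_toHat_eq_of_completes αhat α h, hI]

/-- The same in the image convention: `α̂(ι_X(I_x)) = ι_Y(I_y)`. [cite: MochizukiSemiAnbd2006, Thm 6.12 p.78] -/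
theorem map_map_toHat_inertia_eq_of_completes (αhat : X.PiHat ≃ₜ* Y.PiHat) (α : X.PiTemp ≃ₜ* Y.PiTemp)
    (h : ∀ g : X.PiTemp, αhat (X.toHat g) = Y.toHat (α g)) (x : X.Pt) (y : Y.Pt)
    (hI : (X.inertia x).map α.toMulEquiv.toMonoidHom = Y.inertia y) :
    ((X.inertia x).map X.toHat.toMonoidHom).map αhat.toMulEquiv.toMonoidHom =
      (Y.inertia y).map Y.toHat.toMonoidHom := by
  rw [map_map_toHat_eq_of_completes αhat α h, hI]

/-! ### 2. The law-free engine: Thm. 6.12 at a pair from its profinite analogue for the completed data -/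

/-- **[SemiAnbd] Thm. 6.12 at the pair `(X_K, Y_L, c)` from its profinite analogue** (p. 78: "it is
immediate that the tempered analogue of [Mzk8], Theorem 4.3, holds"; Rmk. 6.12.1: it "follow[s] formally
from [its] profinite analogue").  Hypotheses: `ĉ` — the cyclotome transport along isomorphisms of the
PROFINITE completions (bound datum); `hrigid` — [Mzk8] = [GalSect] Thm. 4.3 for the completed data: for
every `α̂ : Π_{X_K} ⥲ Π_{Y_L}` carrying `Î_x = closure ι_X(I_x)` onto `Î_y` (rational cusps `x`, `y`),
`α̂ ∘ ι_X ∘ (μ → I_x) = ι_Y ∘ (μ → I_y) ∘ ĉ(α̂)`; `hcompat` — the compatibility law `ĉ(α̂) = c.cycloOf α`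
whenever `α̂` completes `α`.  Proof: complete `α` (`temperedIsoCompletes_holds`), transport `α(I_x) = I_y`
to `α̂(Î_x) = Î_y`, apply `hrigid`, rewrite `α̂ ∘ ι_X = ι_Y ∘ α` and `hcompat`, cancel the injection `ι_Y`
(`toHat_injective`). [cite: MochizukiSemiAnbd2006, Thm 6.12 p.78] -/
theorem cuspidalCyclotomicRigidity_of_hat (c : CyclotomeTransport X Y)
    (cHat : (X.PiHat ≃ₜ* Y.PiHat) →
      (cyclotome (AlgebraicClosure ℚ_[p])ˣ ≃* cyclotome (AlgebraicClosure ℚ_[p])ˣ))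
    (hrigid : ∀ (αhat : X.PiHat ≃ₜ* Y.PiHat) (x : X.Pt) (y : Y.Pt), X.IsCusp x → X.IsRationalPt x →
      Y.IsCusp y → Y.IsRationalPt y →
      (((X.inertia x).map X.toHat.toMonoidHom).topologicalClosure).map αhat.toMulEquiv.toMonoidHom =
        ((Y.inertia y).map Y.toHat.toMonoidHom).topologicalClosure →
      ∀ ζ : cyclotome (AlgebraicClosure ℚ_[p])ˣ,
        αhat (X.toHat (c.cycloToInertiaX x ζ)) = Y.toHat (c.cycloToInertiaY y (cHat αhat ζ)))
    (hcompat : ∀ (α : X.PiTemp ≃ₜ* Y.PiTemp) (αhat : X.PiHat ≃ₜ* Y.PiHat),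
      (∀ g : X.PiTemp, αhat (X.toHat g) = Y.toHat (α g)) → cHat αhat = c.cycloOf α) :
    X.CuspidalCyclotomicRigidity Y c := by
  intro α x y hx hxr hy hyr hI ζ
  obtain ⟨αhat, hα⟩ := temperedIsoCompletes_holds X Y α
  have hζ := hrigid αhat x y hx hxr hy hyr (map_closure_inertia_eq_of_completes αhat α hα x y hI) ζ
  rw [hα, hcompat α αhat hα] at hζ
  exact Y.toHat_injective hζ

/-- **Thm. 6.12 at a pair from its profinite analogue, image convention**: the same engine with the
profinite hypothesis stated for `ι_X(I_x)`, `ι_Y(I_y)` without closures (equal to the closures at cusps,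
`closure_map_toHat_inertia_eq`). [cite: MochizukiSemiAnbd2006, Thm 6.12 p.78] -/
theorem cuspidalCyclotomicRigidity_of_hat' (c : CyclotomeTransport X Y)
    (cHat : (X.PiHat ≃ₜ* Y.PiHat) →
      (cyclotome (AlgebraicClosure ℚ_[p])ˣ ≃* cyclotome (AlgebraicClosure ℚ_[p])ˣ))
    (hrigid : ∀ (αhat : X.PiHat ≃ₜ* Y.PiHat) (x : X.Pt) (y : Y.Pt), X.IsCusp x → X.IsRationalPt x →
      Y.IsCusp y → Y.IsRationalPt y →
      ((X.inertia x).map X.toHat.toMonoidHom).map αhat.toMulEquiv.toMonoidHom =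
        (Y.inertia y).map Y.toHat.toMonoidHom →
      ∀ ζ : cyclotome (AlgebraicClosure ℚ_[p])ˣ,
        αhat (X.toHat (c.cycloToInertiaX x ζ)) = Y.toHat (c.cycloToInertiaY y (cHat αhat ζ)))
    (hcompat : ∀ (α : X.PiTemp ≃ₜ* Y.PiTemp) (αhat : X.PiHat ≃ₜ* Y.PiHat),
      (∀ g : X.PiTemp, αhat (X.toHat g) = Y.toHat (α g)) → cHat αhat = c.cycloOf α) :
    X.CuspidalCyclotomicRigidity Y c := by
  intro α x y hx hxr hy hyr hI ζ
  obtain ⟨αhat, hα⟩ := temperedIsoCompletes_holds X Y α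
  have hζ := hrigid αhat x y hx hxr hy hyr (map_map_toHat_inertia_eq_of_completes αhat α hα x y hI) ζ
  rw [hα, hcompat α αhat hα] at hζ
  exact Y.toHat_injective hζ

/-- The two profinite hypotheses agree at cusps: the closure-convention transport statement
`α̂(Î_x) = Î_y` is equivalent to the image-convention one `α̂(ι_X(I_x)) = ι_Y(I_y)`.
[cite: MochizukiSemiAnbd2006, §6 p.77] -/
theorem map_closure_inertia_eq_iff_map_map (αhat : X.PiHat ≃ₜ* Y.PiHat) (x : X.Pt) (y : Y.Pt)
    (hx : X.IsCusp x) (hy : Y.IsCusp y) :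
    (((X.inertia x).map X.toHat.toMonoidHom).topologicalClosure).map αhat.toMulEquiv.toMonoidHom =
        ((Y.inertia y).map Y.toHat.toMonoidHom).topologicalClosure ↔
      ((X.inertia x).map X.toHat.toMonoidHom).map αhat.toMulEquiv.toMonoidHom =
        (Y.inertia y).map Y.toHat.toMonoidHom := by
  rw [closure_map_toHat_inertia_eq x hx, closure_map_toHat_inertia_eq y hy]

end TemperedCurve

/-! ### 3. F-1653 from the profinite [Mzk8] Thm. 4.3 for the completed genuine data -/

namespace AbsolutenessOrigin

variable (Ω : AbsolutenessOrigin p)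

/-- **[SemiAnbd] Thm. 6.12 as printed (`CuspidalCyclotomicRigidityHolds Ω`, FACT-LIST F-1653) FROM its
profinite analogue**, the printed proof (p. 78; Rmk. 6.12.1).  Hypotheses, for every GENUINE pair
`(X_K, Y_L)` with genuine cyclotome data `c` (`Ω.IsHyperbolicCurveOrigin`, `Ω.IsCyclotomeOrigin`):
`ĉ` — the cyclotome transport along isomorphisms of profinite completions (bound datum);
`hrigid` — [Mzk8] = [GalSect] Thm. 4.3 p. 17 (Rigidity of Cuspidal Geometric Decomposition Groups,
profinite; the `TemperedCurve`-side reading of FACT-LIST F-0105 `GalSect.Thm_4_3`) for the completed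
data; `hcompat` — the transport induced by a tempered `α` is the one induced by its completion `α̂`.
A CONDITIONAL reduction: both inputs are hypotheses, never asserted; the universal closure of the
conclusion over `Ω` is refuted in the tree (`not_forall_cuspidalCyclotomicRigidityHolds`), consistently —
the junk certificates there violate `hrigid`/`hcompat`. [cite: MochizukiSemiAnbd2006, Thm 6.12 p.78] -/
theorem cuspidalCyclotomicRigidityHolds_of_profinite
    (cHat : ∀ {X Y : TemperedCurve p}, CyclotomeTransport X Y → (X.PiHat ≃ₜ* Y.PiHat) →
      (cyclotome (AlgebraicClosure ℚ_[p])ˣ ≃* cyclotome (AlgebraicClosure ℚ_[p])ˣ))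
    (hrigid : ∀ (X Y : TemperedCurve p) (c : CyclotomeTransport X Y), Ω.IsHyperbolicCurveOrigin X →
      Ω.IsHyperbolicCurveOrigin Y → Ω.IsCyclotomeOrigin c →
      ∀ (αhat : X.PiHat ≃ₜ* Y.PiHat) (x : X.Pt) (y : Y.Pt), X.IsCusp x → X.IsRationalPt x →
        Y.IsCusp y → Y.IsRationalPt y →
        (((X.inertia x).map X.toHat.toMonoidHom).topologicalClosure).map αhat.toMulEquiv.toMonoidHom =
          ((Y.inertia y).map Y.toHat.toMonoidHom).topologicalClosure →
        ∀ ζ : cyclotome (AlgebraicClosure ℚ_[p])ˣ,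
          αhat (X.toHat (c.cycloToInertiaX x ζ)) = Y.toHat (c.cycloToInertiaY y (cHat c αhat ζ)))
    (hcompat : ∀ (X Y : TemperedCurve p) (c : CyclotomeTransport X Y), Ω.IsHyperbolicCurveOrigin X →
      Ω.IsHyperbolicCurveOrigin Y → Ω.IsCyclotomeOrigin c →
      ∀ (α : X.PiTemp ≃ₜ* Y.PiTemp) (αhat : X.PiHat ≃ₜ* Y.PiHat),
        (∀ g : X.PiTemp, αhat (X.toHat g) = Y.toHat (α g)) → cHat c αhat = c.cycloOf α) :
    Literature.AnabelianGeometry.SemiGraphs.AbsolutenessOrigin.CuspidalCyclotomicRigidityHolds Ω :=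
  fun X Y c hX hY hc =>
    TemperedCurve.cuspidalCyclotomicRigidity_of_hat c (cHat c) (hrigid X Y c hX hY hc)
      (hcompat X Y c hX hY hc)

/-- The same with the profinite Thm. 4.3 in the image convention (`ι_X(I_x)`, no closure).
[cite: MochizukiSemiAnbd2006, Thm 6.12 p.78] -/
theorem cuspidalCyclotomicRigidityHolds_of_profinite'
    (cHat : ∀ {X Y : TemperedCurve p}, CyclotomeTransport X Y → (X.PiHat ≃ₜ* Y.PiHat) →
      (cyclotome (AlgebraicClosure ℚ_[p])ˣ ≃* cyclotome (AlgebraicClosure ℚ_[p])ˣ))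
    (hrigid : ∀ (X Y : TemperedCurve p) (c : CyclotomeTransport X Y), Ω.IsHyperbolicCurveOrigin X →
      Ω.IsHyperbolicCurveOrigin Y → Ω.IsCyclotomeOrigin c →
      ∀ (αhat : X.PiHat ≃ₜ* Y.PiHat) (x : X.Pt) (y : Y.Pt), X.IsCusp x → X.IsRationalPt x →
        Y.IsCusp y → Y.IsRationalPt y →
        ((X.inertia x).map X.toHat.toMonoidHom).map αhat.toMulEquiv.toMonoidHom =
          (Y.inertia y).map Y.toHat.toMonoidHom →
        ∀ ζ : cyclotome (AlgebraicClosure ℚ_[p])ˣ,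
          αhat (X.toHat (c.cycloToInertiaX x ζ)) = Y.toHat (c.cycloToInertiaY y (cHat c αhat ζ)))
    (hcompat : ∀ (X Y : TemperedCurve p) (c : CyclotomeTransport X Y), Ω.IsHyperbolicCurveOrigin X →
      Ω.IsHyperbolicCurveOrigin Y → Ω.IsCyclotomeOrigin c →
      ∀ (α : X.PiTemp ≃ₜ* Y.PiTemp) (αhat : X.PiHat ≃ₜ* Y.PiHat),
        (∀ g : X.PiTemp, αhat (X.toHat g) = Y.toHat (α g)) → cHat c αhat = c.cycloOf α) :
    Literature.AnabelianGeometry.SemiGraphs.AbsolutenessOrigin.CuspidalCyclotomicRigidityHolds Ω :=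
  fun X Y c hX hY hc =>
    TemperedCurve.cuspidalCyclotomicRigidity_of_hat' c (cHat c) (hrigid X Y c hX hY hc)
      (hcompat X Y c hX hY hc)

end AbsolutenessOrigin

end Literature.AnabelianGeometry.SemiGraphs

end
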